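import Mathlib
import Literature.Algebra.Polynomial.CoeffList
import Literature.Algebra.Polynomial.CoeffListPositivity
import Summits.KontsevichZagierPeriods.KontsevichZagierPeriods.Theorems.IsogenyCertificatesJLPairData
import HarnessLib

/-!
# The Jacquet–Langlands correspondence for `X_0^{35}`: sign certificates on `(−∞,−1]`, part A

Support file for `JLPairIdentityX` (stmt-KontsevichZagierPeriods-14655). Kernel-checked sign
certificates (`Literature.Algebra.Polynomial.CoeffListPositivity`: after the substitution
`u = −1 − t` every coefficient is nonnegative — Pólya exponent `0` in all cases) for the polynomials
controlling the real branches of the correspondence `Z` on the half-line `u ≤ −1`: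
`Q > 0`, `disc > 0`, `P₂ > 0`, `16P₂+4P₁+Q < 0`, `81P₂+36P₁+16Q > 0`, `625P₂+275P₁+121Q < 0`,
`Sₙ > 0`, `Rₙ > 0`, `D₁ > 0`, `S_c > 0`. Part B (the turning point of the tiny branch) is in
`IsogenyCertificatesJLPairSignsB.lean`.
-/

namespace Summit.KontsevichZagierPeriods.IsogenyCertificates.JLPair

open Literature.Algebra.Polynomial

/-! ### Sign certificates on `(−∞, −1]` (all with Pólya exponent `0`: after `u = −1 − t` every
coefficient is nonnegative) -/

/-- `Q > 0` on `(−∞, −1]`. [folklore] -/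
theorem Q_pos {u : ℝ} (hu : u ≤ -1) : 0 < CoeffList.eval u cQ :=
  CoeffList.eval_pos_of_le (p := cQ) (a := -1)
    (c := (CoeffList.comp cQ [-1, -1]).headD 0) (q := (CoeffList.comp cQ [-1, -1]).tail)
    (by decide +kernel) (by decide +kernel) (by decide +kernel) (by exact_mod_cast hu)

/-- `disc = P₁² − 4QP₂ > 0` on `(−∞, −1]` (two distinct real branches). [folklore] -/
theorem D_pos {u : ℝ} (hu : u ≤ -1) : 0 < CoeffList.eval u cD :=
  CoeffList.eval_pos_of_le (p := cD) (a := -1)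
    (c := (CoeffList.comp cD [-1, -1]).headD 0) (q := (CoeffList.comp cD [-1, -1]).tail)
    (by decide +kernel) (by decide +kernel) (by decide +kernel) (by exact_mod_cast hu)

/-- `P₂ > 0` on `(−∞, −1)` (so `x₊ x₋ = P₂/Q > 0`). [folklore] -/
theorem P2_pos {u : ℝ} (hu : u < -1) : 0 < CoeffList.eval u cP2 :=
  CoeffList.eval_pos_of_lt (p := cP2) (a := -1) (by decide +kernel) (by decide +kernel)
    (by exact_mod_cast hu)

/-- `16P₂ + 4P₁ + Q < 0` on `(−∞, −1)` (so `(x₊ + 1/4)(x₋ + 1/4) < 0`). [folklore] -/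
theorem B14_neg {u : ℝ} (hu : u < -1) : CoeffList.eval u cB14 < 0 := by
  have h := CoeffList.eval_pos_of_lt (R := ℝ) (p := CoeffList.smul (-1) cB14) (a := -1)
    (by decide +kernel) (by decide +kernel) (u := u) (by exact_mod_cast hu)
  rw [CoeffList.eval_smul] at h
  push_cast at h
  linarith

/-- `81P₂ + 36P₁ + 16Q > 0` on `(−∞, −1)` (so `(x₊ + 4/9)(x₋ + 4/9) > 0`). [folklore] -/
theorem B49_pos {u : ℝ} (hu : u < -1) : 0 < CoeffList.eval u cB49 :=
  CoeffList.eval_pos_of_lt (p := cB49) (a := -1) (by decide +kernel) (by decide +kernel)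
    (by exact_mod_cast hu)

/-- `625P₂ + 275P₁ + 121Q < 0` on `(−∞, −1]` (so `(x₊ + 11/25)(x₋ + 11/25) < 0`: `x₋ < −0.44 < x₊`).
[folklore] -/
theorem B1125_neg {u : ℝ} (hu : u ≤ -1) : CoeffList.eval u cB1125 < 0 := by
  have h := CoeffList.eval_pos_of_le (R := ℝ) (p := CoeffList.smul (-1) cB1125) (a := -1)
    (c := (CoeffList.comp (CoeffList.smul (-1) cB1125) [-1, -1]).headD 0)
    (q := (CoeffList.comp (CoeffList.smul (-1) cB1125) [-1, -1]).tail)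
    (by decide +kernel) (by decide +kernel) (by decide +kernel) (u := u) (by exact_mod_cast hu)
  rw [CoeffList.eval_smul] at h
  push_cast at h
  linarith

/-- `Sₙ = N₁P₁ + 2QN₀ > 0` on `(−∞, −1]`. [folklore] -/
theorem Sn_pos {u : ℝ} (hu : u ≤ -1) : 0 < CoeffList.eval u cSn :=
  CoeffList.eval_pos_of_le (p := cSn) (a := -1)
    (c := (CoeffList.comp cSn [-1, -1]).headD 0) (q := (CoeffList.comp cSn [-1, -1]).tail)
    (by decide +kernel) (by decide +kernel) (by decide +kernel) (by exact_mod_cast hu)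

/-- `Rₙ = Sₙ² − N₁² disc > 0` on `(−∞, −1]`. [folklore] -/
theorem Rn_pos {u : ℝ} (hu : u ≤ -1) : 0 < CoeffList.eval u cRn :=
  CoeffList.eval_pos_of_le (p := cRn) (a := -1)
    (c := (CoeffList.comp cRn [-1, -1]).headD 0) (q := (CoeffList.comp cRn [-1, -1]).tail)
    (by decide +kernel) (by decide +kernel) (by decide +kernel) (by exact_mod_cast hu)

/-- `D₁ > 0` on `(−∞, −1]`. [folklore] -/
theorem D1_pos {u : ℝ} (hu : u ≤ -1) : 0 < CoeffList.eval u cD1 :=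
  CoeffList.eval_pos_of_le (p := cD1) (a := -1)
    (c := (CoeffList.comp cD1 [-1, -1]).headD 0) (q := (CoeffList.comp cD1 [-1, -1]).tail)
    (by decide +kernel) (by decide +kernel) (by decide +kernel) (by exact_mod_cast hu)

/-- `S_c = P₁D₁ − 2QD₂ > 0` on `(−∞, −1]`. [folklore] -/
theorem Sc_pos {u : ℝ} (hu : u ≤ -1) : 0 < CoeffList.eval u cSc :=
  CoeffList.eval_pos_of_le (p := cSc) (a := -1)
    (c := (CoeffList.comp cSc [-1, -1]).headD 0) (q := (CoeffList.comp cSc [-1, -1]).tail)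
    (by decide +kernel) (by decide +kernel) (by decide +kernel) (by exact_mod_cast hu)


end Summit.KontsevichZagierPeriods.IsogenyCertificates.JLPair
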